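import Literature.NumberTheory.Rogawski1990.LocalTransfer
import Literature.NumberTheory.Automorphic.TorusCharacterLocalComponents
import HarnessLib

/-!
# Rogawski's explicit transfer factor `Δ‴_v(γ_H, γ′) = τ_v(γ_H) · D_{G∕H,v}(γ_H) · κ_v(γ_H, γ′)` at a FINITE place `v` of `L⁺`
# (node N1f of `F0/P3a/T6b-TREE.md` §9 (F2): the finite-place members of the explicit global collection of #72)

Topic `NumberTheory/Rogawski1990`; namespace `Literature.NumberTheory.Rogawski1990`.  DEFINITIONS WITH BODIES + unfolding lemmas; **no named
fact, no `sorry`, no instance, no notation**.  Cell `pub/hodgecm-mathlib`, F0∕P3a, typer topic T6 (seat typ-T6b).  The finite-place twin of ★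
`ArchExplicitTransferFactor` (p826337) ∕ ★ `ArchCanonicalTransferFactor`: the EXPLICIT local factors at which the #72 letter ★
`GlobalTransferWithCartanKappaFormula … Δ_∞ …` (`∃ (Δ_v)_v`: local transfer, unit fundamental lemma, canonical measures, a.e. triviality, product formula,
(4.3.3)) is to be paid down (T6-L3, day 2): with `Δ_v := Δ‴_v` the last three clauses become COMPUTATIONS (nodes N3, N4, N5 of T6b-TREE §9), the first two
stay print's citations [LS₂], [BR₁] stated AT this factor (N6, N7).  HONEST LABEL: HC_CM is proved only modulo the printed citations («named inputs
remaining 2») until rung 0 closes; nothing here proves any of them, and nothing here is a `Prop` awaiting proof.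

THE PRINT [Rogawski1990 §4.9 p. 55, local `F = L⁺_v`, `E = L ⊗ L⁺_v = ∏_{w ∣ v} L_w`]: for `γ = ι(g, u) ∈ H ⊂ G` with eigenvalues `γ₁, γ₂ = u, γ₃`
(«labelled so that `γ` is of the form `(* 0 *; 0 γ₂ 0; * 0 *)`»), `τ(γ) = μ(γ₂) μ⁻¹((γ₂γ₁⁻¹ − 1)(1 − γ₂γ₃⁻¹))`, `D_{G∕H}(γ) = D_G(γ)∕D_H(γ) = |Π_{α ∉ H}(1 − α(γ))|_F^{1∕2}`,
`Δ_{G∕H}(γ) = τ(γ) D_{G∕H}(γ)`, and (4.9.1) `Δ_{G∕H}(γ) Φ^κ(γ, f) = Φ^st(γ, f^H)` with `Φ^κ(γ, f) = Σ_{γ′ ∼_st γ} κ(inv(γ, γ′)) Φ(γ′, f)` [§4.3 p. 43]; «It is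
easy to check that this definition of `Δ_{G∕H}` arises from the construction of [LS]» [p. 55].  The tree's local transfer identity (★ `IsLocalTransferDatum`,
`IsDeltaTransferRel`: `Φ^st_H(γ_H, f^H) = Σ_{[γ′]} Δ_v(γ_H, γ′) Φ([γ′], f)`) puts the `κ`-weight INSIDE the two-variable factor, so the factor to type is
  `Δ‴_v(γ_H, γ′) = [ι(γ_H) ↔ γ′] · τ_v(γ_H) · D_{G∕H,v}(γ_H) · κ_v(γ_H, γ′)`, `κ_v(γ_H, γ′) = κ(inv(ι(γ_H), γ′)) ∈ {±1}`.
EIGENVALUE-FREE and CONJUGATOR-FREE forms (as at `∞`): `(γ₂γ₁⁻¹ − 1)(1 − γ₂γ₃⁻¹) = −χ_g(u)∕det g`; `Π_{α∉H}(1 − α(γ)) = N_{E∕F}(χ_g(u)∕u²)` (`ᾱ = α⁻¹` on the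
eigenvalues of unitary elements), so `D_{G∕H,v} = |N_{E∕F} χ_g(u)|_F^{1∕2} = (Π_{w∣v} ‖χ_g(u)_w‖_w)^{1∕2}` with Mathlib's normalised `‖·‖_w` on `L_w`
(`NumberField.Completion.FinitePlace`: `‖x‖ = q_w^{−w(x)}`, and `|N z|_F = Π_{w∣v} ‖z_w‖_w`); and for the relative position: the centraliser torus of the
regular `ι(γ_H)` is `T = (Π_i E_i)^{N=1}` over the τ-stable factors of `E[ι(γ_H)]`, `H¹(F, T) = Π_i F_i^×∕N E_i^×`, `κ` is the character non-trivial exactly on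
the DEGREE-ONE factor `i₀` of the eigenvalue `u` (`F_{i₀} = F`, `E_{i₀} = E`) [§3.5 Prop. 3.5.2 (c); §4.9: «`κ ∈ R(G_γ∕F)` is the element corresponding to `H`»],
and `inv(ι(γ_H), γ′)_{i₀}` is the class modulo `N(E^×)` of `x = pᴴ · H′ · p ∈ F^×` for ANY `u`-eigenvector `p` of `γ′` (for `γ′ = c ι(γ_H) c⁻¹`:
`X(c) := Φ₃⁻¹ c⋆H′c` commutes with `ι(γ_H)` and is τ-fixed since `ι⋆Φ₃ι = Φ₃`, `γ′⋆H′γ′ = H′`; its `i₀`-coordinate is `e₂⋆c⋆H′c e₂ = pᴴH′p` with `p = c e₂`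
because `Φ₃(e₂, e₂) = 1`; `c ↦ g′ c t` multiplies it by `N(t_{i₀})`).  A `u`-eigenvector WITHOUT choosing `c`: every column of `P_v := χ_g(γ′) =
γ′² − tr(g) γ′ + det(g)` (on a matching pair `P_v = χ_g(u) · (c e₂)(e₂ᵀ c⁻¹)` has rank ≤ 1, cf. ★ `archEigenlineProjector_eq_vecMulVec_of_isArchNormPair` — the
same algebra over any commutative ring).  Hence
  `κ_v(γ_H, γ′) := +1` if `x ∈ N(E^×)` (`x = z z̄` for a unit `z` of `E = L_w`, `v` non-split), `−1` otherwise; `+1` at split `v` (`H¹ = 0`); `0` bookkept when `P_v = 0`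
  (off the `G`-regular pairs) —
`d`-free and equal to the Hilbert symbol `(x, d)_v` for any `d` with `L = L⁺(√d)` (★ `hilbertSymbol`, ★ `quadraticNormSubgroup`; the currency of ★
`quadraticArtinIndicator_eq_natCast_ncard`, by which `Π_{v ≤ ∞} κ_v` is Kottwitz's obstruction coordinate — node N5).  At a place `v` SPLIT in `L` every
τ-fixed unit of `L⁺_v × L⁺_v` is a norm, so `κ_v = +1` there («`+1` for almost all `v`», p. 242).
WHAT IS DEFINED (all at a finite place `v` of `L⁺`, on the ★ `cmDatum` local carriers; `μ : HeckeCharacter L` read at `v` through ★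
`HeckeCharacter.semilocalComponent`): §1 `finHeckeValue`; §2 `finGammaTwo`, `finCharpolyTwo`, `finTauArg`, `finTau`; §3 `finWeylRatio` (+ `_nonneg`); §4
`finEigenlineProjector`, `finColumnFormValue`, `finRelPos`, `finKappaAt`; §5 `finExplicitDelta` (+ support ∕ unfolding lemmas); §6 `finExplicitTransferFactor μ v hl hr :
LocalTransferFactor L H′ v` with the two conjugation invariances as HYPOTHESES whose types are the statements to prove (nodes N1f-l, N1f-r — provers' work,
exactly as N1a-l∕N1a-r were: `u`, `χ_g`, `det g` are class functions of `γ_H`; `P_v ↦ y P_v y⁻¹`, `y⋆H′y = H′`, and the norm class of `pᴴH′p` is a congruence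
invariant), and the global finite collection `finExplicitCollection μ hl hr : ∀ v, LocalTransferFactor L H′ v` (the `Δ` slot of #72).
NOT here (provers, T6b-TREE §9): well-definedness lemmas (the norm class of `finColumnFormValue … j` is independent of the non-zero column `j`), N1f-l∕r,
non-degeneracy N2f (`χ_g(u) ≠ 0` and `x ≠ 0` on `G`-regular matching pairs — the functional argument of the N2∞ brief), N3 a.e. triviality, N4 product
formula, N5 (4.3.3), and the central-character rule `Δ(zγ_H, zγ′) = μ(z)Δ(γ_H, γ′)` (p. 55).

## References
* [Rogawski1990] J. D. Rogawski, *Automorphic Representations of Unitary Groups in Three Variables*, Ann. of Math. Stud. 123 (1990): §4.9 p. 55 (`τ`, `D_{G∕H}`,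
  `Δ_{G∕H}`, (4.9.1), «arises from the construction of [LS]»; held e-text chunks p0059–p0060), §4.3 pp. 43–44 (`Φ^κ`, (4.3.3)), §3.5 Prop. 3.5.2 (c) p. 29
  (`H¹(F, T)` on the τ-stable factors), §14.6 p. 242 (`Δ″_v`, «`+1` for almost all `v`»).
* [LanglandsShelstad1987] R. P. Langlands, D. Shelstad, *On the definition of transfer factors*, Math. Ann. 278 (1987), §1–§2 (`inv(γ_H, γ_G)`, `κ`), §6.4.
-/

set_option autoImplicit false

noncomputable section

open NumberField IsDedekindDomain Matrix Polynomial
open Literature.NumberTheory.GaloisRepresentations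
open scoped MatrixGroups

namespace Literature.NumberTheory.Rogawski1990

open Literature.NumberTheory.Automorphic

variable (L : Type) [Field L] [NumberField L] (v : HeightOneSpectrum (𝓞 ↥(maximalRealSubfield L)))

/-! ## §1 `μ_v` on `E = ∏_{w ∣ v} L_w` -/

open scoped Classical in
/-- **`μ_v(x)`**: the value of the Hecke character `μ` of `L` on the idèle which is `x` at the places `w ∣ v` and `1` elsewhere, when `x ∈ ∏_{w∣v} L_w` is a
unit (★ `HeckeCharacter.semilocalComponent μ v = ∏_{w∣v} μ_w`), and `0` at non-units (never read there: `τ_v` is evaluated at units on the support of `Δ‴_v`).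
[cite: Rogawski1990, §4.9 p. 55] [cite: TateThesis1967, §4.3] -/
def finHeckeValue (μ : HeckeCharacter L) (x : UnitaryGroup.LocalRing L v) : ℂ :=
  if h : IsUnit x then ((μ.semilocalComponent L v h.unit : ℂˣ) : ℂ) else 0

/-- `μ_v` at a non-unit is `0` (bookkeeping). [cite: Rogawski1990, §4.9 p. 55] -/
theorem finHeckeValue_of_not_isUnit (μ : HeckeCharacter L) {x : UnitaryGroup.LocalRing L v} (hx : ¬ IsUnit x) :
    finHeckeValue L v μ x = 0 := by
  classical
  exact dif_neg hx

/-- `μ_v` at a unit is the semi-local component (bookkeeping). [cite: Rogawski1990, §4.9 p. 55] -/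
theorem finHeckeValue_of_isUnit (μ : HeckeCharacter L) {x : UnitaryGroup.LocalRing L v} (hx : IsUnit x) :
    finHeckeValue L v μ x = ((μ.semilocalComponent L v hx.unit : ℂˣ) : ℂ) := by
  classical
  exact dif_pos hx

/-! ## §2 `γ₂`, `χ_g`, `τ_v` for `γ_H = (g, γ₂) ∈ H_v = U(Φ₂)(L⁺_v) × U(Φ₁)(L⁺_v)` -/

section H

variable [IsCMField L] (H' : Matrix (Fin 3) (Fin 3) L)
  (γH : (UnitaryGroup.cmDatum L 2 (Matrix.of fun i j : Fin 2 => if i.val + j.val + 1 = 2 then (1 : L) else 0)).Local v ×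
      (UnitaryGroup.cmDatum L 1 (Matrix.of fun i j : Fin 1 => if i.val + j.val + 1 = 1 then (1 : L) else 0)).Local v)

/-- **`γ₂`** at `v`: the entry of the `U(Φ₁)`-coordinate of `γ_H` (the distinguished eigenvalue of `ι_v(γ_H)`). [cite: Rogawski1990, §4.9 p. 55] -/
def finGammaTwo : UnitaryGroup.LocalRing L v :=
  (γH.2.val.val : Matrix (Fin 1) (Fin 1) (UnitaryGroup.LocalRing L v)) 0 0

/-- **`χ_g`** at `v`: the characteristic polynomial of the `U(Φ₂)`-part `g` of `γ_H` (roots = print's `γ₁, γ₃`). [cite: Rogawski1990, §4.9 p. 55] -/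
def finCharpolyTwo : Polynomial (UnitaryGroup.LocalRing L v) :=
  (γH.1.val.val : Matrix (Fin 2) (Fin 2) (UnitaryGroup.LocalRing L v)).charpoly

/-- **`(γ₂γ₁⁻¹ − 1)(1 − γ₂γ₃⁻¹) = −χ_g(γ₂) · det g⁻¹`**, eigenvalue-free. [cite: Rogawski1990, §4.9 p. 55] -/
def finTauArg : UnitaryGroup.LocalRing L v :=
  -((finCharpolyTwo L v γH).eval (finGammaTwo L v γH)) *
    ((γH.1.val⁻¹).val : Matrix (Fin 2) (Fin 2) (UnitaryGroup.LocalRing L v)).det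

/-- **`τ_v(γ_H) = μ_v(γ₂) · μ_v((γ₂γ₁⁻¹ − 1)(1 − γ₂γ₃⁻¹))⁻¹`**. [cite: Rogawski1990, §4.9 p. 55] -/
def finTau (μ : HeckeCharacter L) : ℂ :=
  finHeckeValue L v μ (finGammaTwo L v γH) * (finHeckeValue L v μ (finTauArg L v γH))⁻¹

/-! ## §3 `D_{G∕H,v}` -/

/-- **`D_{G∕H,v}(γ_H) = |N_{E∕F} χ_g(γ₂)|_F^{1∕2} = (Π_{w ∣ v} ‖χ_g(γ₂)_w‖_w)^{1∕2}`** with Mathlib's normalised absolute values on the completions `L_w` — print's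
`|Π_{α ∉ H}(1 − α(γ))|_F^{1∕2}` (file header: `Π_{α∉H}(1 − α) = N(χ_g(u)∕u²)`, `|N u| = 1`). [cite: Rogawski1990, §4.9 p. 55] -/
def finWeylRatio : ℝ :=
  Real.sqrt (∏ w : UnitaryGroup.PlacesOver L v, ‖(finCharpolyTwo L v γH).eval (finGammaTwo L v γH) w‖)

/-- `D_{G∕H,v} ≥ 0`. [cite: Rogawski1990, §4.9 p. 55] -/
theorem finWeylRatio_nonneg : 0 ≤ finWeylRatio L v γH :=
  Real.sqrt_nonneg _

/-! ## §4 The relative position `x_v(γ_H, γ′)` and the sign `κ_v(γ_H, γ′)` -/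

/-- **`P_v(γ_H, γ′) = χ_g(γ′) = γ′² − tr(g)·γ′ + det(g)·1 ∈ M₃(∏_{w∣v} L_w)`** — on a matching pair its columns span the `γ₂`-eigenline of `γ′`.
[cite: Rogawski1990, §4.9 p. 55] -/
def finEigenlineProjector (γ' : (UnitaryGroup.cmDatum L 3 H').Local v) : Matrix (Fin 3) (Fin 3) (UnitaryGroup.LocalRing L v) :=
  let g : Matrix (Fin 2) (Fin 2) (UnitaryGroup.LocalRing L v) := γH.1.val.val
  let x : Matrix (Fin 3) (Fin 3) (UnitaryGroup.LocalRing L v) := γ'.val.val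
  x * x - g.trace • x + g.det • (1 : Matrix (Fin 3) (Fin 3) (UnitaryGroup.LocalRing L v))

/-- **`x_j := p_jᴴ · H′_v · p_j`** for the `j`-th column `p_j` of `P_v` (`ᴴ` = transpose ∘ `(c ⊗ 1)`, ★ `UnitaryGroup.conjLocal`; `H′_v` = the local form ★
`(adelicForm L 3 H′).map (adeleToLocal L v)` of ★ `IsLocalNormPair`). [cite: Rogawski1990, §3.5 Prop. 3.5.2 (c) p. 29; §4.9 p. 55] -/
def finColumnFormValue (γ' : (UnitaryGroup.cmDatum L 3 H').Local v) (j : Fin 3) : UnitaryGroup.LocalRing L v :=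
  ∑ i : Fin 3, ∑ k : Fin 3,
    UnitaryGroup.conjLocal L (IsCMField.complexConj L) v (finEigenlineProjector L v H' γH γ' i j) *
      ((UnitaryGroup.adelicForm L 3 H').map (UnitaryGroup.adeleToLocal L v)) i k * finEigenlineProjector L v H' γH γ' k j

open scoped Classical in
/-- **The relative position `x_v(γ_H, γ′) ∈ ∏_{w∣v} L_w`**: the `H′_v`-value of the FIRST non-zero column of `P_v` (a `γ₂`-eigenvector of `γ′` on a matching
pair), `0` if `P_v = 0`; τ-fixed, and — at a non-split `v`, the only case in which it is read — its class modulo norms is `inv(ι_v(γ_H), γ′)` at the degree-one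
factor (file header; independence of the column = provers' lemma; at a split `v` a column may vanish at one of the two places, and `κ_v := +1` directly). [cite: Rogawski1990, §3.5 Prop. 3.5.2 (c) p. 29; §4.3 p. 43] [cite: LanglandsShelstad1987, §1] -/
def finRelPos (γ' : (UnitaryGroup.cmDatum L 3 H').Local v) : UnitaryGroup.LocalRing L v :=
  if h : ∃ j : Fin 3, ∃ i : Fin 3, finEigenlineProjector L v H' γH γ' i j ≠ 0 then
    finColumnFormValue L v H' γH γ' (Fin.find (fun j : Fin 3 => ∃ i : Fin 3, finEigenlineProjector L v H' γH γ' i j ≠ 0) h)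
  else 0

open scoped Classical in
/-- **`κ_v(γ_H, γ′) ∈ {−1, 0, 1}`** — `0` if `P_v = 0` (off the `G`-regular pairs); otherwise the value of the endoscopic character `κ` on
`inv(ι_v(γ_H), γ′)`: at a place `v` SPLIT in `L` (two places `w ≠ w̄` above `v`, `E = L⁺_v × L⁺_v`, `H¹(L⁺_v, T) = 0` on the degree-one factor) it is `+1`
(«it is `+1` for almost all `v`»; this also avoids reading `x_v` at a column of `P_v` that vanishes at one of the two places); at a NON-SPLIT `v` (one place
`w` above `v`, `E = L_w` a field, so every non-zero column of `P_v` is a unit multiple of the eigenvector and `x_v` is well defined modulo `N(L_w^×)`) it is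
`+1` if the relative position `x_v` is a NORM from the units of `L_w` (`x = z · (c ⊗ 1) z`, `z` a unit) and `−1` if not — the `d`-free form of the Hilbert
symbol `(x_v, d)_v`, `L = L⁺(√d)` (★ `hilbertSymbol`, ★ `quadraticNormSubgroup`).  «`κ(γ, ψ_v(i(γ)))` is equal to `±1` and it is `+1` for almost all `v`».
[cite: Rogawski1990, §14.6 p. 242; §4.3 p. 43; §3.5 Prop. 3.5.2 (c) p. 29] [cite: LanglandsShelstad1987, §2] -/
def finKappaAt (γ' : (UnitaryGroup.cmDatum L 3 H').Local v) : ℤ :=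
  if finEigenlineProjector L v H' γH γ' = 0 then 0
  else if ¬ Subsingleton (UnitaryGroup.PlacesOver L v) then 1
  else if ∃ z : UnitaryGroup.LocalRing L v, IsUnit z ∧
      finRelPos L v H' γH γ' = z * UnitaryGroup.conjLocal L (IsCMField.complexConj L) v z then 1
  else -1

open scoped Classical in
/-- `κ_v = +1` at a split place on the support of `P_v` (unfolding). [cite: Rogawski1990, §14.6 p. 242] -/
theorem finKappaAt_of_not_subsingleton {γ' : (UnitaryGroup.cmDatum L 3 H').Local v} (hP : finEigenlineProjector L v H' γH γ' ≠ 0)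
    (hv : ¬ Subsingleton (UnitaryGroup.PlacesOver L v)) : finKappaAt L v H' γH γ' = 1 := by
  unfold finKappaAt
  rw [if_neg hP, if_pos hv]

open scoped Classical in
/-- `κ_v = 0` off the support of `P_v` (unfolding). [cite: Rogawski1990, §4.3 p. 43] -/
theorem finKappaAt_of_projector_eq_zero {γ' : (UnitaryGroup.cmDatum L 3 H').Local v} (hP : finEigenlineProjector L v H' γH γ' = 0) :
    finKappaAt L v H' γH γ' = 0 := by
  unfold finKappaAt
  rw [if_pos hP]

/-! ## §5 `Δ‴_v` -/

open scoped Classical in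
/-- **ROGAWSKI'S EXPLICIT FINITE-PLACE FACTOR `Δ‴_v(γ_H, γ′) = τ_v(γ_H) · D_{G∕H,v}(γ_H) · κ_v(γ_H, γ′)`** on the matching pairs `ι_v(γ_H) ↔ γ′` (★
`IsLocalNormPair`), `0` off them. [cite: Rogawski1990, §4.9 p. 55; §4.3 p. 43; §14.6 p. 242] -/
def finExplicitDelta (μ : HeckeCharacter L) (γ' : (UnitaryGroup.cmDatum L 3 H').Local v) : ℂ :=
  if IsLocalNormPair L H' v γH γ' then
    finTau L v γH μ * (finWeylRatio L v γH : ℂ) * ((finKappaAt L v H' γH γ' : ℤ) : ℂ)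
  else 0

open scoped Classical in
/-- Support: `Δ‴_v(γ_H, γ′) = 0` unless `ι_v(γ_H) ↔ γ′`. [cite: Rogawski1990, §4.3 p. 43] -/
theorem finExplicitDelta_of_not_isLocalNormPair (μ : HeckeCharacter L) {γ' : (UnitaryGroup.cmDatum L 3 H').Local v}
    (h : ¬ IsLocalNormPair L H' v γH γ') : finExplicitDelta L v H' γH μ γ' = 0 :=
  if_neg h

open scoped Classical in
/-- On a matching pair `Δ‴_v = τ_v · D_{G∕H,v} · κ_v` (unfolding). [cite: Rogawski1990, §4.9 p. 55; §14.6 p. 242] -/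
theorem finExplicitDelta_of_isLocalNormPair (μ : HeckeCharacter L) {γ' : (UnitaryGroup.cmDatum L 3 H').Local v}
    (h : IsLocalNormPair L H' v γH γ') :
    finExplicitDelta L v H' γH μ γ' = finTau L v γH μ * (finWeylRatio L v γH : ℂ) * ((finKappaAt L v H' γH γ' : ℤ) : ℂ) :=
  if_pos h

end H

/-! ## §6 `Δ‴_v` as a ★ `LocalTransferFactor` (conjugation invariance supplied by the caller) and the finite collection -/

section Factor

variable [IsCMField L] (H' : Matrix (Fin 3) (Fin 3) L) (μ : HeckeCharacter L)

open scoped Classical in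
/-- **`Δ‴_v` AS A ★ `LocalTransferFactor L H′ v`** — ★ `TransferFactorData` on the local carriers: support on ★ `IsLocalNormPair` (proved), invariance under
conjugation of `γ_H` in `H_v` and of `γ′` in `G′_v` taken as the caller's hypotheses `hl`, `hr`, whose TYPES are the statements to prove (nodes N1f-l, N1f-r;
no fact is minted). [cite: Rogawski1990, §4.3 p. 43; §4.9 p. 55] -/
def finExplicitTransferFactor
    (hl : ∀ (a : (UnitaryGroup.cmDatum L 2 (Matrix.of fun i j : Fin 2 => if i.val + j.val + 1 = 2 then (1 : L) else 0)).Local v ×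
      (UnitaryGroup.cmDatum L 1 (Matrix.of fun i j : Fin 1 => if i.val + j.val + 1 = 1 then (1 : L) else 0)).Local v)
      (b : (UnitaryGroup.cmDatum L 3 H').Local v)
      (x : (UnitaryGroup.cmDatum L 2 (Matrix.of fun i j : Fin 2 => if i.val + j.val + 1 = 2 then (1 : L) else 0)).Local v ×
      (UnitaryGroup.cmDatum L 1 (Matrix.of fun i j : Fin 1 => if i.val + j.val + 1 = 1 then (1 : L) else 0)).Local v),
      finExplicitDelta L v H' (x * a * x⁻¹) μ b = finExplicitDelta L v H' a μ b)
    (hr : ∀ (a : (UnitaryGroup.cmDatum L 2 (Matrix.of fun i j : Fin 2 => if i.val + j.val + 1 = 2 then (1 : L) else 0)).Local v ×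
      (UnitaryGroup.cmDatum L 1 (Matrix.of fun i j : Fin 1 => if i.val + j.val + 1 = 1 then (1 : L) else 0)).Local v)
      (b y : (UnitaryGroup.cmDatum L 3 H').Local v),
      finExplicitDelta L v H' a μ (y * b * y⁻¹) = finExplicitDelta L v H' a μ b) :
    LocalTransferFactor L H' v where
  Δ a b := finExplicitDelta L v H' a μ b
  eq_zero_of_not_rel a _ h := finExplicitDelta_of_not_isLocalNormPair L v H' a μ h
  conj_left a b x := hl a b x
  conj_right a b y := hr a b y

open scoped Classical in
/-- The factor's `Δ` is `Δ‴_v` (definitional). [cite: Rogawski1990, §4.9 p. 55] -/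
@[simp] theorem finExplicitTransferFactor_Δ
    (hl : ∀ (a : (UnitaryGroup.cmDatum L 2 (Matrix.of fun i j : Fin 2 => if i.val + j.val + 1 = 2 then (1 : L) else 0)).Local v ×
      (UnitaryGroup.cmDatum L 1 (Matrix.of fun i j : Fin 1 => if i.val + j.val + 1 = 1 then (1 : L) else 0)).Local v)
      (b : (UnitaryGroup.cmDatum L 3 H').Local v)
      (x : (UnitaryGroup.cmDatum L 2 (Matrix.of fun i j : Fin 2 => if i.val + j.val + 1 = 2 then (1 : L) else 0)).Local v ×
      (UnitaryGroup.cmDatum L 1 (Matrix.of fun i j : Fin 1 => if i.val + j.val + 1 = 1 then (1 : L) else 0)).Local v),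
      finExplicitDelta L v H' (x * a * x⁻¹) μ b = finExplicitDelta L v H' a μ b)
    (hr : ∀ (a : (UnitaryGroup.cmDatum L 2 (Matrix.of fun i j : Fin 2 => if i.val + j.val + 1 = 2 then (1 : L) else 0)).Local v ×
      (UnitaryGroup.cmDatum L 1 (Matrix.of fun i j : Fin 1 => if i.val + j.val + 1 = 1 then (1 : L) else 0)).Local v)
      (b y : (UnitaryGroup.cmDatum L 3 H').Local v),
      finExplicitDelta L v H' a μ (y * b * y⁻¹) = finExplicitDelta L v H' a μ b)
    (a : (UnitaryGroup.cmDatum L 2 (Matrix.of fun i j : Fin 2 => if i.val + j.val + 1 = 2 then (1 : L) else 0)).Local v ×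
      (UnitaryGroup.cmDatum L 1 (Matrix.of fun i j : Fin 1 => if i.val + j.val + 1 = 1 then (1 : L) else 0)).Local v)
    (b : (UnitaryGroup.cmDatum L 3 H').Local v) :
    (finExplicitTransferFactor L v H' μ hl hr).Δ a b = finExplicitDelta L v H' a μ b :=
  rfl

end Factor

section Collection

variable [IsCMField L] (H' : Matrix (Fin 3) (Fin 3) L) (μ : HeckeCharacter L)

open scoped Classical in
/-- **The explicit FINITE COLLECTION `(Δ‴_v)_v`** — the `Δ : ∀ v, LocalTransferFactor L H′ v` slot of the #72 letter ★ `GlobalTransferWithCartanKappaFormula`,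
given the two invariance families. [cite: Rogawski1990, §4.9 p. 55; §14.6 p. 242] -/
def finExplicitCollection
    (hl : ∀ (v : HeightOneSpectrum (𝓞 ↥(maximalRealSubfield L)))
      (a : (UnitaryGroup.cmDatum L 2 (Matrix.of fun i j : Fin 2 => if i.val + j.val + 1 = 2 then (1 : L) else 0)).Local v ×
      (UnitaryGroup.cmDatum L 1 (Matrix.of fun i j : Fin 1 => if i.val + j.val + 1 = 1 then (1 : L) else 0)).Local v)
      (b : (UnitaryGroup.cmDatum L 3 H').Local v)
      (x : (UnitaryGroup.cmDatum L 2 (Matrix.of fun i j : Fin 2 => if i.val + j.val + 1 = 2 then (1 : L) else 0)).Local v ×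
      (UnitaryGroup.cmDatum L 1 (Matrix.of fun i j : Fin 1 => if i.val + j.val + 1 = 1 then (1 : L) else 0)).Local v),
      finExplicitDelta L v H' (x * a * x⁻¹) μ b = finExplicitDelta L v H' a μ b)
    (hr : ∀ (v : HeightOneSpectrum (𝓞 ↥(maximalRealSubfield L)))
      (a : (UnitaryGroup.cmDatum L 2 (Matrix.of fun i j : Fin 2 => if i.val + j.val + 1 = 2 then (1 : L) else 0)).Local v ×
      (UnitaryGroup.cmDatum L 1 (Matrix.of fun i j : Fin 1 => if i.val + j.val + 1 = 1 then (1 : L) else 0)).Local v)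
      (b y : (UnitaryGroup.cmDatum L 3 H').Local v),
      finExplicitDelta L v H' a μ (y * b * y⁻¹) = finExplicitDelta L v H' a μ b)
    (v : HeightOneSpectrum (𝓞 ↥(maximalRealSubfield L))) : LocalTransferFactor L H' v :=
  finExplicitTransferFactor L v H' μ (hl v) (hr v)

open scoped Classical in
/-- The collection's member at `v` has `Δ = Δ‴_v` (definitional). [cite: Rogawski1990, §4.9 p. 55] -/
@[simp] theorem finExplicitCollection_Δ
    (hl : ∀ (v : HeightOneSpectrum (𝓞 ↥(maximalRealSubfield L)))
      (a : (UnitaryGroup.cmDatum L 2 (Matrix.of fun i j : Fin 2 => if i.val + j.val + 1 = 2 then (1 : L) else 0)).Local v ×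
      (UnitaryGroup.cmDatum L 1 (Matrix.of fun i j : Fin 1 => if i.val + j.val + 1 = 1 then (1 : L) else 0)).Local v)
      (b : (UnitaryGroup.cmDatum L 3 H').Local v)
      (x : (UnitaryGroup.cmDatum L 2 (Matrix.of fun i j : Fin 2 => if i.val + j.val + 1 = 2 then (1 : L) else 0)).Local v ×
      (UnitaryGroup.cmDatum L 1 (Matrix.of fun i j : Fin 1 => if i.val + j.val + 1 = 1 then (1 : L) else 0)).Local v),
      finExplicitDelta L v H' (x * a * x⁻¹) μ b = finExplicitDelta L v H' a μ b)
    (hr : ∀ (v : HeightOneSpectrum (𝓞 ↥(maximalRealSubfield L)))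
      (a : (UnitaryGroup.cmDatum L 2 (Matrix.of fun i j : Fin 2 => if i.val + j.val + 1 = 2 then (1 : L) else 0)).Local v ×
      (UnitaryGroup.cmDatum L 1 (Matrix.of fun i j : Fin 1 => if i.val + j.val + 1 = 1 then (1 : L) else 0)).Local v)
      (b y : (UnitaryGroup.cmDatum L 3 H').Local v),
      finExplicitDelta L v H' a μ (y * b * y⁻¹) = finExplicitDelta L v H' a μ b)
    (v : HeightOneSpectrum (𝓞 ↥(maximalRealSubfield L)))
    (a : (UnitaryGroup.cmDatum L 2 (Matrix.of fun i j : Fin 2 => if i.val + j.val + 1 = 2 then (1 : L) else 0)).Local v ×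
      (UnitaryGroup.cmDatum L 1 (Matrix.of fun i j : Fin 1 => if i.val + j.val + 1 = 1 then (1 : L) else 0)).Local v)
    (b : (UnitaryGroup.cmDatum L 3 H').Local v) :
    (finExplicitCollection L H' μ hl hr v).Δ a b = finExplicitDelta L v H' a μ b :=
  rfl

end Collection

end Literature.NumberTheory.Rogawski1990

end
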